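import Summits.Langlands.Langlands.Theorems.SqrtFiveQuarticCoversCertB3E7MordellWeil

/-!
# Route `Langlands/SqrtFiveQuarticCovers`, certificate `CertB3E7` (sheet 4.5) — BRIDGE between the
# two bare forms of the Mordell–Weil datum of `X(e7)`: the `W`-form `hMW` and the `C`-form `hE7k` are
# KERNEL-EQUIVALENT (`kPoints_of_fixedPointsW`, `fixedPointsW_of_kPoints`)
# (cell `pub/lg-quartmod`, F-L1, NAMED-INPUT TABLE row 8 / seat E7-MW-GROUPLAW; CONDITIONAL bookkeeping)

Companion to `…CertB3E7MordellWeil.lean` (this seat: `mordellWeilE7_of_kPoints (hE7k)`, the group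
law of `X(e7)` read on `x` PROVED from the `C`-form point list `hE7k` = «every point of FLS's printed
model `C : y² = 7q(x)` with both coordinates in `ℚ + ℚ·r` has `3x + 1 = 0`») and to the cell's
second, method-disjoint kernel lineage for the same reduction (typ-1 g0, Mathlib group law on the
Weierstrass model `W : Y² = X³ + 294X² − 343X ≅_ℚ 49a4`, file HOME/lg-quartmod-typ-1/
SqrtFiveQuarticCoversCertB3E7MordellWeil.lean 5cf9334eb7bf55da), whose named input is the `W`-FORM
`hMW` = «for `σ ≠ id` fixing `r`: every `σ`-fixed affine `K`-point of `W` is `(0,0)`» (lead g2 RULING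
22:21:59Z: the form closest to the certnum datum RELEASES l.140 K1 LV0 + K2 TORE, which speak about
`49a4 / ℚ(√5)`; `W → 49a4 = [1,−1,0,−1822,30393]` by `(u,r,s,t) = (2,−99,1,0)`, typ-1 iso49a4.py).

PROVED here: `kPoints_of_fixedPointsW : hMW → hE7k` and the converse `fixedPointsW_of_kPoints :
hE7k → hMW` (§3: the inverse map `ψ = φ⁻¹`, `x = (28X − Y)/(3Y − 56X)` from typ-1's ratio (I2), with
certificate `(4yD²)² − 112·q(x)·D⁴ = −12544·X³·(Y² − X³ − 294X² + 343X)` and the corner `3Y = 56X`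
killed by `√7 ∉ ℚ(√5)`) — so the two bare forms are KERNEL-EQUIVALENT named inputs, and both are
served by this lineage: the term `mordellWeilE7_of_kPoints (kPoints_of_fixedPointsW hMW)`
has the type of the stub «MordellWeilE7» of stmt-Langlands-23416 (the same statement is in the tree as
typ-1's `mordellWeilE7_of_fixedPoints`, `…CertB3E7GroupLaw.lean` p674866, by Mathlib's group law —
two kernel derivations of row 8 from the single input `hMW`), and
`certB3E7_of_modelIdentification_inf_of_fixedPointsW_of_census (hK1inf) (hMW) (hZmm) (hZmi) : CertB3E7`
BY NAME.  Proof of the bridge (typ-1's identities, e7mw/README.md 4b5b16f18ef5d10a, re-checked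
exactly here: HOME/lg-quartmod-eng-8/code/e7mw/verify_bridge.py): for `(x, y) ∈ C(K)` with
`x, y ∈ ℚ + ℚ·r` and `3x + 1 ≠ 0`, the map `φ(x,y) = (X, Y) = (7N/(3x+1)², 196(2x+1)N/(3x+1)³)`,
`N = 35x² + 98x + 4y + 35` [phi3.py; Riemann–Roch at `O = (−1/3, 14/9)`] lands on `W`
((I1): `(196(2x+1)N)² − [(7N)³ + 294(7N)²(3x+1)² − 343·7N·(3x+1)⁴] = −5488·N·(y² − 7q)`, cert1.py)
at a point fixed by the quadratic automorphism `σ` of `K/ℚ(r)` (`exists_ringHom_ne_id_fixing_sqrt_five`);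
`hMW` gives `X = 0`, i.e. `N = 0`, i.e. `4y = −(35x² + 98x + 35)`, and then (I5)
`16·7q(x) − (35x² + 98x + 35)² = 7(3x+1)⁴` forces `3x + 1 = 0` — contradiction.

HONEST STATUS: conditional bookkeeping over one explicit quartic family; the Mordell–Weil datum (rank
`0` of `49a4` over `ℚ(√5)`: Kolyvagin–Logachev + exact `L`-values, certnum l.140) stays NAMED in either
form; «a certified finite datum is not a modularity or BSD statement»; nothing here proves modularity
of a new class of elliptic curves.
References: [FreitasLeHungSiksek2015] Lemma 4.2, p. 28 (arXiv:1310.7088); [SilvermanAEC2009] III.1,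
III.2–3; cell record CENSUS.md §15 row 4.5, NAMED-INPUT TABLE row 8.
-/

set_option linter.dupNamespace false -- project-wide option (lakefile weak.linter.dupNamespace); `Summit.Langlands.Langlands` is the mandated namespace

namespace Summit.Langlands.Langlands.Theorems.SqrtFiveQuarticCovers

open scoped Matrix

/-! ## 1. The bridge `hMW → hE7k` -/

/-- **`W`-form ⇒ `C`-form of the Mordell–Weil datum of `X(e7)` over `ℚ(√5)`.**  If for every quartic
number field `K ∋ r`, `r² = 5`, and every ring endomorphism `σ ≠ id` of `K` fixing `r` the `σ`-fixed
affine `K`-points of `W : Y² = X³ + 294X² − 343X` reduce to `(0,0)` (`hMW`), then every point of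
`C : y² = 7(16x⁴+68x³+111x²+62x+11)` with both coordinates in `ℚ + ℚ·r` has `3x + 1 = 0`.  Via
typ-1's map `φ = (7N/(3x+1)², 196(2x+1)N/(3x+1)³)`, `N = 35x²+98x+4y+35`, identity (I1) (cert1.py)
and (I5) `112q − (35x²+98x+35)² = 7(3x+1)⁴`; the automorphism `σ` from
`exists_ringHom_ne_id_fixing_sqrt_five`. [folklore] [cite: SilvermanAEC2009, III.1 and III.2–3] -/
theorem kPoints_of_fixedPointsW
    (hMW : ∀ (K : Type) [Field K] [NumberField K], Module.finrank ℚ K = 4 → ∀ r : K, r ^ 2 = 5 →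
        ∀ σ : K →+* K, σ r = r → σ ≠ RingHom.id K →
          ∀ X Y : K, σ X = X → σ Y = Y → Y ^ 2 = X ^ 3 + 294 * X ^ 2 - 343 * X → X = 0 ∧ Y = 0) :
    ∀ (K : Type) [Field K] [NumberField K], Module.finrank ℚ K = 4 → ∀ r : K, r ^ 2 = 5 →
        ∀ x y : K, (∃ a b : ℚ, x = (a : K) + (b : K) * r) → (∃ a b : ℚ, y = (a : K) + (b : K) * r) →
          y ^ 2 = 7 * (16 * x ^ 4 + 68 * x ^ 3 + 111 * x ^ 2 + 62 * x + 11) → 3 * x + 1 = 0 := by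
  intro K _ _ hd r hr x y hx hy hC
  obtain ⟨a, b, hab⟩ := hx
  obtain ⟨c, d, hcd⟩ := hy
  obtain ⟨σ, hσr, hσ, -⟩ := exists_ringHom_ne_id_fixing_sqrt_five hd hr
  have hσx : σ x = x := by rw [hab, map_add, map_mul, map_ratCast, map_ratCast, hσr]
  have hσy : σ y = y := by rw [hcd, map_add, map_mul, map_ratCast, map_ratCast, hσr]
  by_contra h3
  have hs2 : (3 * x + 1) ^ 2 ≠ 0 := pow_ne_zero 2 h3
  have hs3 : (3 * x + 1) ^ 3 ≠ 0 := pow_ne_zero 3 h3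
  -- typ-1's map `φ = (X, Y)`
  obtain ⟨X, hX⟩ : ∃ X : K, X = 7 * (35 * x ^ 2 + 98 * x + 4 * y + 35) / (3 * x + 1) ^ 2 := ⟨_, rfl⟩
  obtain ⟨Y, hY⟩ : ∃ Y : K,
      Y = 196 * (2 * x + 1) * (35 * x ^ 2 + 98 * x + 4 * y + 35) / (3 * x + 1) ^ 3 := ⟨_, rfl⟩
  have hXs : X * (3 * x + 1) ^ 2 = 7 * (35 * x ^ 2 + 98 * x + 4 * y + 35) := by
    rw [hX]; exact div_mul_cancel₀ _ hs2
  have hYs : Y * (3 * x + 1) ^ 3 = 196 * (2 * x + 1) * (35 * x ^ 2 + 98 * x + 4 * y + 35) := by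
    rw [hY]; exact div_mul_cancel₀ _ hs3
  -- (I1): `φ(x,y)` lies on `W`
  have key : (196 * (2 * x + 1) * (35 * x ^ 2 + 98 * x + 4 * y + 35)) ^ 2 =
      (7 * (35 * x ^ 2 + 98 * x + 4 * y + 35)) ^ 3 +
        294 * (7 * (35 * x ^ 2 + 98 * x + 4 * y + 35)) ^ 2 * (3 * x + 1) ^ 2 -
        343 * (7 * (35 * x ^ 2 + 98 * x + 4 * y + 35)) * (3 * x + 1) ^ 4 := by
    linear_combination (-5488 * (35 * x ^ 2 + 98 * x + 4 * y + 35)) * hC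
  have hW6 : (Y ^ 2 - (X ^ 3 + 294 * X ^ 2 - 343 * X)) * ((3 * x + 1) ^ 2) ^ 3 = 0 := by
    have h : (Y * (3 * x + 1) ^ 3) ^ 2 - ((X * (3 * x + 1) ^ 2) ^ 3 +
        294 * (X * (3 * x + 1) ^ 2) ^ 2 * (3 * x + 1) ^ 2 -
        343 * (X * (3 * x + 1) ^ 2) * (3 * x + 1) ^ 4) = 0 := by
      rw [hXs, hYs]; linear_combination key
    linear_combination h
  have hW : Y ^ 2 = X ^ 3 + 294 * X ^ 2 - 343 * X :=
    sub_eq_zero.1 ((mul_eq_zero.1 hW6).resolve_right (pow_ne_zero 3 hs2))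
  -- `φ(x,y)` is `σ`-fixed, hence `= (0,0)` by `hMW`
  have hσX : σ X = X := by
    rw [hX]; simp only [map_div₀, map_mul, map_add, map_pow, map_ofNat, map_one, hσx, hσy]
  have hσY : σ Y = Y := by
    rw [hY]; simp only [map_div₀, map_mul, map_add, map_pow, map_ofNat, map_one, hσx, hσy]
  obtain ⟨hX0, -⟩ := hMW K hd r hr σ hσr hσ X Y hσX hσY hW
  -- `X = 0` ⇒ `N = 0` ⇒ (I5) ⇒ `(3x+1)⁴ = 0`
  have hN : 35 * x ^ 2 + 98 * x + 4 * y + 35 = 0 := by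
    have h7 : 7 * (35 * x ^ 2 + 98 * x + 4 * y + 35) = 0 := by
      rw [← hXs, hX0, zero_mul]
    linear_combination h7 / 7
  have h4 : (3 * x + 1) ^ 4 = 0 := by
    linear_combination (-16 / 7) * hC + ((4 * y - (35 * x ^ 2 + 98 * x + 35)) / 7) * hN
  exact h3 (pow_eq_zero_iff (by norm_num) |>.1 h4)

/-! ## 2. `CertB3E7` from the `W`-form through this lineage -/

set_option maxHeartbeats 1000000 in -- four written-out hypothesis types with `decide`d matrix entries; statement elaboration only
/-- **`CertB3E7` BY NAME (stmt-Langlands-23416, sheet 4.5) from NF-K1-E10∞ (`hK1inf`, p672401), the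
`W`-FORM Mordell–Weil datum `hMW` and the certified census (`hZmm`, `hZmi`):**
`certB3E7_of_modelIdentification_inf_of_kPoints_of_census hK1inf (kPoints_of_fixedPointsW hMW) hZmm hZmi`
— this lineage's derivation; the cell's other lineage gives the same statement as
`certB3E7_of_modelIdentification_inf_of_census hK1inf (mordellWeilE7_of_fixedPoints hMW) hZmm hZmi`
(typ-1, `…CertB3E7GroupLaw.lean`, p674866).
CONDITIONAL bookkeeping (binders `hK1inf`, `hZmm`, `hZmi` byte-identical to p672401 / p670569); «a
certified finite datum is not a modularity statement»; nothing here proves modularity of a new class.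
[cite: FreitasLeHungSiksek2015, Lemma 4.2 (p. 28)] [cite: Box2022, §1.1 and Thm. 7.1] -/
theorem certB3E7_of_modelIdentification_inf_of_fixedPointsW_of_census
    (hK1inf : ∀ (K : Type) [Field K] [NumberField K], Module.finrank ℚ K = 4 → (∃ r : K, r ^ 2 = 5) →
        ∀ E : WeierstrassCurve (NumberField.RingOfIntegers K), E.Δ ≠ 0 →
          (∃ ρ : Literature.NumberTheory.GaloisRepresentations.FramedGaloisRep K (ZMod 3) 2, (∃ e : (E.baseChange K).geomTorsion ((3 : ℕ) : ℤ) ≃+ (Fin 2 → ZMod 3), ∀ (σ : Field.absoluteGaloisGroup K) (P : (E.baseChange K).geomTorsion ((3 : ℕ) : ℤ)), e (σ • P) = ((ρ σ : GL (Fin 2) (ZMod 3)) : Matrix (Fin 2) (Fin 2) (ZMod 3)) *ᵥ (e P)) ∧ ((∀ σ : Field.absoluteGaloisGroup K, (((ρ σ : GL (Fin 2) (ZMod 3)) : Matrix (Fin 2) (Fin 2) (ZMod 3)) 1 0 = 0)))) →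
          (∃ ρ : Literature.NumberTheory.GaloisRepresentations.FramedGaloisRep K (ZMod 7) 2, (∃ e : (E.baseChange K).geomTorsion ((7 : ℕ) : ℤ) ≃+ (Fin 2 → ZMod 7), ∀ (σ : Field.absoluteGaloisGroup K) (P : (E.baseChange K).geomTorsion ((7 : ℕ) : ℤ)), e (σ • P) = ((ρ σ : GL (Fin 2) (ZMod 7)) : Matrix (Fin 2) (Fin 2) (ZMod 7)) *ᵥ (e P)) ∧ ((∀ σ : Field.absoluteGaloisGroup K, (ρ σ : GL (Fin 2) (ZMod 7)) ∈ Subgroup.closure ({(⟨!![0, 5; 3, 0], !![0, 5; 3, 0], by decide, by decide⟩ : GL (Fin 2) (ZMod 7)), (⟨!![5, 0; 3, 2], !![3, 0; 6, 4], by decide, by decide⟩ : GL (Fin 2) (ZMod 7))} : Set (GL (Fin 2) (ZMod 7)))))) →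
          ((E.baseChange K).c₄ ^ 3 = 1728 * (E.baseChange K).Δ ∨
           (∃ x₁ y₁ x₂ y₂ : K, y₁ ^ 2 = 7 * (16 * x₁ ^ 4 + 68 * x₁ ^ 3 + 111 * x₁ ^ 2 + 62 * x₁ + 11) ∧ y₂ ^ 2 = 7 * (16 * x₂ ^ 4 + 68 * x₂ ^ 3 + 111 * x₂ ^ 2 + 62 * x₂ + 11) ∧
            ((x₁ ^ 3 + x₁ ^ 2 - 2 * x₁ - 1) ^ 7) ≠ 0 ∧
            (E.baseChange K).c₄ ^ 3 * ((x₁ ^ 3 + x₁ ^ 2 - 2 * x₁ - 1) ^ 7) = ((3 * x₁ + 1) ^ 3 * (4 * x₁ ^ 2 + 5 * x₁ + 2) ^ 3 * (x₁ ^ 2 + 3 * x₁ + 4) ^ 3 * (x₁ ^ 2 + 10 * x₁ + 4) ^ 3) * (E.baseChange K).Δ ∧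
            ((3 * x₂ ^ 2 + 6 * x₂ + 2) ^ 2 * x₁ ^ 4 + (36 * x₂ ^ 4 + 125 * x₂ ^ 3 + 138 * x₂ ^ 2 + 60 * x₂ + 9) * x₁ ^ 3 + (48 * x₂ ^ 4 + 138 * x₂ ^ 3 + 111 * x₂ ^ 2 + 33 * x₂ + 3) * x₁ ^ 2 + (24 * x₂ ^ 4 + 60 * x₂ ^ 3 + 33 * x₂ ^ 2 + 5 * x₂) * x₁ + (4 * x₂ ^ 4 + 9 * x₂ ^ 3 + 3 * x₂ ^ 2)) = 0) ∨
           (∃ x₁ y₁ z : K, y₁ ^ 2 = 7 * (16 * x₁ ^ 4 + 68 * x₁ ^ 3 + 111 * x₁ ^ 2 + 62 * x₁ + 11) ∧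
            ((x₁ ^ 3 + x₁ ^ 2 - 2 * x₁ - 1) ^ 7) ≠ 0 ∧
            (E.baseChange K).c₄ ^ 3 * ((x₁ ^ 3 + x₁ ^ 2 - 2 * x₁ - 1) ^ 7) = ((3 * x₁ + 1) ^ 3 * (4 * x₁ ^ 2 + 5 * x₁ + 2) ^ 3 * (x₁ ^ 2 + 3 * x₁ + 4) ^ 3 * (x₁ ^ 2 + 10 * x₁ + 4) ^ 3) * (E.baseChange K).Δ ∧
            (3 * x₁ ^ 2 + 6 * x₁ + 2) ^ 2 = 0 ∧ z ^ 2 = 7)))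
    (hMW : ∀ (K : Type) [Field K] [NumberField K], Module.finrank ℚ K = 4 → ∀ r : K, r ^ 2 = 5 →
        ∀ σ : K →+* K, σ r = r → σ ≠ RingHom.id K →
          ∀ X Y : K, σ X = X → σ Y = Y → Y ^ 2 = X ^ 3 + 294 * X ^ 2 - 343 * X → X = 0 ∧ Y = 0)
        (hZmm : ∀ (K : Type) [Field K] [NumberField K], Module.finrank ℚ K = 4 → (∃ r : K, r ^ 2 = 5) →
        ∀ x₁ y₁ x₂ x₁' x₂' : K, y₁ ^ 2 = 7 * (16 * x₁ ^ 4 + 68 * x₁ ^ 3 + 111 * x₁ ^ 2 + 62 * x₁ + 11) →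
          ((3 * x₂ ^ 2 + 6 * x₂ + 2) ^ 2 * x₁ ^ 4 + (36 * x₂ ^ 4 + 125 * x₂ ^ 3 + 138 * x₂ ^ 2 + 60 * x₂ + 9) * x₁ ^ 3 + (48 * x₂ ^ 4 + 138 * x₂ ^ 3 + 111 * x₂ ^ 2 + 33 * x₂ + 3) * x₁ ^ 2 + (24 * x₂ ^ 4 + 60 * x₂ ^ 3 + 33 * x₂ ^ 2 + 5 * x₂) * x₁ + (4 * x₂ ^ 4 + 9 * x₂ ^ 3 + 3 * x₂ ^ 2)) = 0 →
          (12 * x₁ + 5) * x₁' = -(5 * x₁ + 2) → (12 * x₂ + 5) * x₂' = -(5 * x₂ + 2) →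
          ((3 * x₂' ^ 2 + 6 * x₂' + 2) ^ 2 * x₁' ^ 4 + (36 * x₂' ^ 4 + 125 * x₂' ^ 3 + 138 * x₂' ^ 2 + 60 * x₂' + 9) * x₁' ^ 3 + (48 * x₂' ^ 4 + 138 * x₂' ^ 3 + 111 * x₂' ^ 2 + 33 * x₂' + 3) * x₁' ^ 2 + (24 * x₂' ^ 4 + 60 * x₂' ^ 3 + 33 * x₂' ^ 2 + 5 * x₂') * x₁' + (4 * x₂' ^ 4 + 9 * x₂' ^ 3 + 3 * x₂' ^ 2)) = 0 →
          (3 * x₁ + 1 = 0 ∨ x₁ ^ 2 + 10 * x₁ + 4 = 0))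
        (hZmi : ∀ (K : Type) [Field K] [NumberField K], Module.finrank ℚ K = 4 → (∃ r : K, r ^ 2 = 5) →
        ∀ x₁ y₁ x₂ x₁' : K, y₁ ^ 2 = 7 * (16 * x₁ ^ 4 + 68 * x₁ ^ 3 + 111 * x₁ ^ 2 + 62 * x₁ + 11) →
          ((3 * x₂ ^ 2 + 6 * x₂ + 2) ^ 2 * x₁ ^ 4 + (36 * x₂ ^ 4 + 125 * x₂ ^ 3 + 138 * x₂ ^ 2 + 60 * x₂ + 9) * x₁ ^ 3 + (48 * x₂ ^ 4 + 138 * x₂ ^ 3 + 111 * x₂ ^ 2 + 33 * x₂ + 3) * x₁ ^ 2 + (24 * x₂ ^ 4 + 60 * x₂ ^ 3 + 33 * x₂ ^ 2 + 5 * x₂) * x₁ + (4 * x₂ ^ 4 + 9 * x₂ ^ 3 + 3 * x₂ ^ 2)) = 0 →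
          (12 * x₁ + 5) * x₁' = -(5 * x₁ + 2) →
          ((3 * x₂ ^ 2 + 6 * x₂ + 2) ^ 2 * x₁' ^ 4 + (36 * x₂ ^ 4 + 125 * x₂ ^ 3 + 138 * x₂ ^ 2 + 60 * x₂ + 9) * x₁' ^ 3 + (48 * x₂ ^ 4 + 138 * x₂ ^ 3 + 111 * x₂ ^ 2 + 33 * x₂ + 3) * x₁' ^ 2 + (24 * x₂ ^ 4 + 60 * x₂ ^ 3 + 33 * x₂ ^ 2 + 5 * x₂) * x₁' + (4 * x₂ ^ 4 + 9 * x₂ ^ 3 + 3 * x₂ ^ 2)) = 0 →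
          3 * x₁ + 1 = 0) :
    Summit.Langlands.Langlands.Theses.SqrtFiveQuarticCovers.CertB3E7 :=
  certB3E7_of_modelIdentification_inf_of_kPoints_of_census hK1inf (kPoints_of_fixedPointsW hMW) hZmm hZmi

/-! ## 3. The converse bridge `hE7k → hMW`: the two bare forms are kernel-equivalent -/

/-- **`C`-form ⇒ `W`-form of the Mordell–Weil datum of `X(e7)` over `ℚ(√5)`** (converse of
`kPoints_of_fixedPointsW`; with it the two bare named-input forms of NAMED-INPUT TABLE row 8 are
KERNEL-EQUIVALENT, so RECORD v2's choice of the `W`-form `hMW` is canonical).  Given `hE7k`, for `K`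
quartic, `r² = 5`, `σ ≠ id` fixing `r` and a `σ`-fixed affine point `(X, Y)` of
`W : Y² = X³ + 294X² − 343X`: `X = Y = 0`.  Proof: `σ`-fixed means `∈ ℚ + ℚ·r`
(`ringHom_fixing_sqrt_five_sq_eq_id`); if `X ≠ 0` and `3Y = 56X` then `X² − (490/9)X − 343 = 0`,
i.e. `((9X − 245)/112)² = 7` with `X ∈ ℚ + ℚ·r` — impossible (`7`, `35` are not squares,
`isSquare_or_isSquare_five_mul_of_sq_eq`); if `X ≠ 0` and `D := 3Y − 56X ≠ 0`, the INVERSE of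
typ-1's `φ` — `x = (28X − Y)/D` (typ-1's ratio (I2): `x` is a Möbius function of `Y/X`),
`4y·D² = 112X³ − 35(28X−Y)² − 98(28X−Y)D − 35D²` — is a `σ`-fixed point of `C : y² = 7q(x)`
(certificate `(4yD²)² − 112·q(x)D⁴ = −12544·X³·(Y² − X³ − 294X² + 343X)`, checked exactly in
HOME/lg-quartmod-eng-8/code/e7mw/verify_converse.py) with `3x + 1 = 28X/D ≠ 0`, contradicting `hE7k`.
[folklore] [cite: SilvermanAEC2009, III.1 and III.2–3] -/
theorem fixedPointsW_of_kPoints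
    (hE7k : ∀ (K : Type) [Field K] [NumberField K], Module.finrank ℚ K = 4 → ∀ r : K, r ^ 2 = 5 →
        ∀ x y : K, (∃ a b : ℚ, x = (a : K) + (b : K) * r) → (∃ a b : ℚ, y = (a : K) + (b : K) * r) →
          y ^ 2 = 7 * (16 * x ^ 4 + 68 * x ^ 3 + 111 * x ^ 2 + 62 * x + 11) → 3 * x + 1 = 0) :
    ∀ (K : Type) [Field K] [NumberField K], Module.finrank ℚ K = 4 → ∀ r : K, r ^ 2 = 5 →
        ∀ σ : K →+* K, σ r = r → σ ≠ RingHom.id K →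
          ∀ X Y : K, σ X = X → σ Y = Y → Y ^ 2 = X ^ 3 + 294 * X ^ 2 - 343 * X → X = 0 ∧ Y = 0 := by
  intro K _ _ hd r hr σ hσr hσ X Y hσX hσY hW
  by_cases hX : X = 0
  · refine ⟨hX, ?_⟩
    have hY2 : Y ^ 2 = 0 := by rw [hW, hX]; ring
    exact pow_eq_zero_iff two_ne_zero |>.1 hY2
  exfalso
  obtain ⟨-, hfix⟩ := ringHom_fixing_sqrt_five_sq_eq_id hd hr σ hσr hσ
  by_cases hD : 3 * Y - 56 * X = 0
  · -- the corner `3Y = 56X`: `((9X − 245)/112)² = 7` with `X ∈ ℚ + ℚ·r`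
    have hYX : Y = 56 / 3 * X := by linear_combination hD / 3
    have hq3 : X * (X ^ 2 - 490 / 9 * X - 343) = 0 := by
      linear_combination (-1) * hW + (Y + 56 / 3 * X) * hYX
    have hq : X ^ 2 - 490 / 9 * X - 343 = 0 := (mul_eq_zero.1 hq3).resolve_left hX
    obtain ⟨a, b, hab⟩ := hfix X hσX
    have h7 : ((((9 * a - 245) / 112 : ℚ) : K) + (((9 * b / 112 : ℚ)) : K) * r) ^ 2 = ((7 : ℕ) : K) := by
      rw [hab] at hq
      push_cast
      linear_combination (81 / 12544) * hq
    rcases isSquare_or_isSquare_five_mul_of_sq_eq hr h7 with h | h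
    · exact nat_not_isSquare_of_between_squares (k := 2) (by norm_num) (by norm_num) h
    · exact nat_not_isSquare_of_between_squares (k := 5) (by norm_num) (by norm_num) h
  · -- the inverse map `ψ(X, Y) = (x, y)` lands on `C`, `σ`-fixed, with `3x + 1 ≠ 0`
    obtain ⟨x, hx⟩ : ∃ x : K, x = (28 * X - Y) / (3 * Y - 56 * X) := ⟨_, rfl⟩
    obtain ⟨y, hy⟩ : ∃ y : K, y = (112 * X ^ 3 - 35 * (28 * X - Y) ^ 2 -
        98 * (28 * X - Y) * (3 * Y - 56 * X) - 35 * (3 * Y - 56 * X) ^ 2) /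
          (4 * (3 * Y - 56 * X) ^ 2) := ⟨_, rfl⟩
    have hD2 : 4 * (3 * Y - 56 * X) ^ 2 ≠ 0 := mul_ne_zero (by norm_num) (pow_ne_zero 2 hD)
    have hxD : x * (3 * Y - 56 * X) = 28 * X - Y := by rw [hx]; exact div_mul_cancel₀ _ hD
    have hyD : y * (4 * (3 * Y - 56 * X) ^ 2) = 112 * X ^ 3 - 35 * (28 * X - Y) ^ 2 -
        98 * (28 * X - Y) * (3 * Y - 56 * X) - 35 * (3 * Y - 56 * X) ^ 2 := by
      rw [hy]; exact div_mul_cancel₀ _ hD2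
    -- `(x, y) ∈ C`
    have key : (112 * X ^ 3 - 35 * (28 * X - Y) ^ 2 - 98 * (28 * X - Y) * (3 * Y - 56 * X) -
        35 * (3 * Y - 56 * X) ^ 2) ^ 2 = 112 * (16 * (28 * X - Y) ^ 4 +
        68 * (28 * X - Y) ^ 3 * (3 * Y - 56 * X) + 111 * (28 * X - Y) ^ 2 * (3 * Y - 56 * X) ^ 2 +
        62 * (28 * X - Y) * (3 * Y - 56 * X) ^ 3 + 11 * (3 * Y - 56 * X) ^ 4) := by
      linear_combination (-12544 * X ^ 3) * hW
    have hC16 : (y ^ 2 - 7 * (16 * x ^ 4 + 68 * x ^ 3 + 111 * x ^ 2 + 62 * x + 11)) *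
        (16 * (3 * Y - 56 * X) ^ 4) = 0 := by
      have h : (y * (4 * (3 * Y - 56 * X) ^ 2)) ^ 2 - 112 * (16 * (x * (3 * Y - 56 * X)) ^ 4 +
          68 * (x * (3 * Y - 56 * X)) ^ 3 * (3 * Y - 56 * X) +
          111 * (x * (3 * Y - 56 * X)) ^ 2 * (3 * Y - 56 * X) ^ 2 +
          62 * (x * (3 * Y - 56 * X)) * (3 * Y - 56 * X) ^ 3 + 11 * (3 * Y - 56 * X) ^ 4) = 0 := by
        rw [hxD, hyD]; linear_combination key
      linear_combination h
    have hC : y ^ 2 = 7 * (16 * x ^ 4 + 68 * x ^ 3 + 111 * x ^ 2 + 62 * x + 11) :=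
      sub_eq_zero.1 ((mul_eq_zero.1 hC16).resolve_right
        (mul_ne_zero (by norm_num) (pow_ne_zero 4 hD)))
    -- `σ`-fixed, hence both coordinates in `ℚ + ℚ·r`
    have hσx : σ x = x := by
      rw [hx]; simp only [map_div₀, map_sub, map_mul, map_ofNat, hσX, hσY]
    have hσy : σ y = y := by
      rw [hy]; simp only [map_div₀, map_sub, map_mul, map_pow, map_ofNat, hσX, hσY]
    -- `3x + 1 = 28X/D ≠ 0`
    have h3 : 3 * x + 1 ≠ 0 := by
      intro h
      apply hX
      have h28 : 28 * X = (3 * x + 1) * (3 * Y - 56 * X) := by linear_combination (-3) * hxD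
      rw [h, zero_mul] at h28
      linear_combination h28 / 28
    exact h3 (hE7k K hd r hr x y (hfix x hσx) (hfix y hσy) hC)

end Summit.Langlands.Langlands.Theorems.SqrtFiveQuarticCovers
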